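import Mathlib
import Literature.NumberTheory.Irrationality.BrownZudilin2022.GeneralFamily
import Literature.NumberTheory.Irrationality.BrownZudilin2022.CubicalForm
import Literature.NumberTheory.Irrationality.BrownZudilin2022.BarnesRepresentation
import Summits.KontsevichZagierPeriods.Zeta5Search.WedgeDictionaryKernel

/-!
# (H1)-free NATIVE cellular relations, part A: the homogeneous J-level master lemma (cell `pub-zeta5`, lineage gen-1, g21)

HONEST FRAMING: systematic search; no irrationality claim unless certified.  Structure of gen-1's period dictionary
(`WedgeDictionary.explicitPQ`, an OPEN conjecture node) only; nothing about linear forms or ζ(5); nothing is evaluated.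

OUR work (Summit side).  Inputs, as HYPOTHESES (named Literature facts of Brown–Zudilin, arXiv:2210.03391): F2 = `barnes_double`
(`BarnesRepresentation.lean`: for `p, q ≥ 0` and `(c₁,c₂)` in the `Chamber`, `J(p;q) = K(p;q)·(4π²)⁻¹ ∫∫ barnesKernel p q (−c₁+iy₁) (−c₂+iy₂)`);
the companion cell files add F1 = `cellularIntegral_eq_cubicalIntegral`, `cubicalIntegral_eq_Jintegral` (`CubicalForm.lean`).
No hypergeometric input (H1), no invariance group (F3), no numerics.

* `jsum_of_kernel` — the HOMOGENEOUS master lemma: finitely many 12-parameter points `(pᵢ;qᵢ)` with letters `≥ 0` (family points or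
  VIRTUAL ones), integer contour shifts `nᵢ` with `(c₁+nᵢ₁, c₂+nᵢ₂) ∈ ChamberQ (pᵢ) (qᵢ)`, complex coefficients `κᵢ`, and a POINTWISE identity
  `Σᵢ κᵢ Φᵢ(ref(y) − nᵢ) = 0` on the common reference contour `(c₁,c₂) ∈ ℚ²` ⇒ `Σᵢ κᵢ · J(pᵢ;qᵢ)/K(pᵢ;qᵢ) = 0` (F2 at every point +
  linearity of the Bochner integral).  Companion of g20's inhomogeneous `Kernel.corner_of_certificate` (`WedgeDictionaryKernel.lean`).
* `barnesPrefactor_gamma` / `barnesPrefactor_gamma'` — the prefactor `K(p;q)` (a factorial quotient) in Γ-form, under non-negativity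
  of the seven letters it involves; `gamma_int_succ`.
* `chamberQ_bounds` / `chamberQ_intro` (ten plain inequalities ⟺ `ChamberQ`), `letters_nonneg` (`Converges a` and a rational chamber
  point for `(pOf a; qOf a)` ⇒ all twelve letters `≥ 0`), `ne_zero_of_re_ne`.
The twelve native `CellStar`/`CellPencil` instances with symbolic parameters are the files `WedgeDictionaryKernelCells<Cell>.lean`.
-/

set_option maxHeartbeats 1600000
set_option linter.style.longLine false
set_option linter.unusedVariables false


namespace Summit.KontsevichZagierPeriods.Zeta5Search.WedgeDictionary.KernelCells

open Literature.NumberTheory.Irrationality.BrownZudilin2022 MeasureTheory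
open Summit.KontsevichZagierPeriods.Zeta5Search.WedgeDictionary.Kernel

/-! ## 1. The J-level master lemma: a homogeneous kernel identity on shifted contours ⇒ a relation among the `J(pᵢ;qᵢ)` -/

/-- **Master lemma (homogeneous, J-level).**  Finitely many 12-parameter points `(pᵢ;qᵢ)` with non-negative letters (family
points or VIRTUAL ones), integer contour shifts `nᵢ` with `(c₁+nᵢ₁, c₂+nᵢ₂)` in the chamber of point `i`, complex coefficients
`κᵢ`, and a POINTWISE identity `Σᵢ κᵢ Φᵢ(ref(y) − nᵢ) = 0` on the reference contour give `Σᵢ κᵢ · J(pᵢ;qᵢ) / K(pᵢ;qᵢ) = 0`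
(F2 = `barnes_double` at every point + linearity of the Bochner integral).  Virtual points enter in pairs with the same letters,
opposite coefficients and different shifts, and cancel in the conclusion. -/
theorem jsum_of_kernel {k : ℕ} (hF2 : barnes_double)
    (p : Fin k → Fin 7 → ℤ) (q : Fin k → Fin 5 → ℤ) (n₁ n₂ : Fin k → ℤ) (κ : Fin k → ℂ) (c₁ c₂ : ℚ)
    (hpos : ∀ i j, 0 ≤ p i j) (hqpos : ∀ i j, 0 ≤ q i j)
    (hch : ∀ i, ChamberQ (p i) (q i) (c₁ + n₁ i) (c₂ + n₂ i))
    (hker : ∀ y : ℝ × ℝ,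
      ∑ i, κ i * barnesKernel (p i) (q i) ((-((c₁ : ℝ) : ℂ) + (y.1 : ℂ) * Complex.I) - (n₁ i : ℂ))
          ((-((c₂ : ℝ) : ℂ) + (y.2 : ℂ) * Complex.I) - (n₂ i : ℂ)) = 0) :
    ∑ i, κ i / (barnesPrefactor (p i) (q i) : ℂ) * (Jintegral (p i) (q i) : ℂ) = 0 := by
  have hpt : ∀ (pp : Fin 7 → ℤ) (qq : Fin 5 → ℤ) (e₁ e₂ : ℤ) (y : ℝ × ℝ),
      barnesKernel pp qq (-((((c₁ + e₁ : ℚ) : ℝ)) : ℂ) + (y.1 : ℂ) * Complex.I) (-((((c₂ + e₂ : ℚ) : ℝ)) : ℂ) + (y.2 : ℂ) * Complex.I) =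
        barnesKernel pp qq ((-((c₁ : ℝ) : ℂ) + (y.1 : ℂ) * Complex.I) - (e₁ : ℂ)) ((-((c₂ : ℝ) : ℂ) + (y.2 : ℂ) * Complex.I) - (e₂ : ℂ)) := by
    intro pp qq e₁ e₂ y
    congr 1 <;> push_cast <;> ring
  have hR : ∀ i, MeasureTheory.Integrable (fun y : ℝ × ℝ => barnesKernel (p i) (q i)
        ((-((c₁ : ℝ) : ℂ) + (y.1 : ℂ) * Complex.I) - (n₁ i : ℂ)) ((-((c₂ : ℝ) : ℂ) + (y.2 : ℂ) * Complex.I) - (n₂ i : ℂ))) ∧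
      (Jintegral (p i) (q i) : ℂ) = (barnesPrefactor (p i) (q i) : ℂ) * ((4 : ℂ) * (Real.pi : ℂ) ^ 2)⁻¹ *
        ∫ y : ℝ × ℝ, barnesKernel (p i) (q i) ((-((c₁ : ℝ) : ℂ) + (y.1 : ℂ) * Complex.I) - (n₁ i : ℂ))
          ((-((c₂ : ℝ) : ℂ) + (y.2 : ℂ) * Complex.I) - (n₂ i : ℂ)) := by
    intro i
    have h := hF2 (p i) (q i) ((c₁ + n₁ i : ℚ) : ℝ) ((c₂ + n₂ i : ℚ) : ℝ) (hpos i) (hqpos i) (chamber_of_chamberQ (hch i))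
    simp_rw [hpt] at h
    exact h
  have hK : ∀ i, (barnesPrefactor (p i) (q i) : ℂ) ≠ 0 := fun i => by
    exact_mod_cast (barnesPrefactor_pos (p i) (q i)).ne'
  -- linearity: Σ κᵢ ∫ Φᵢ = ∫ Σ κᵢ Φᵢ = ∫ 0 = 0
  have hlin : ∑ i, κ i * ∫ y : ℝ × ℝ, barnesKernel (p i) (q i) ((-((c₁ : ℝ) : ℂ) + (y.1 : ℂ) * Complex.I) - (n₁ i : ℂ))
          ((-((c₂ : ℝ) : ℂ) + (y.2 : ℂ) * Complex.I) - (n₂ i : ℂ)) = 0 := by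
    have h1 : ∑ i, κ i * ∫ y : ℝ × ℝ, barnesKernel (p i) (q i) ((-((c₁ : ℝ) : ℂ) + (y.1 : ℂ) * Complex.I) - (n₁ i : ℂ))
          ((-((c₂ : ℝ) : ℂ) + (y.2 : ℂ) * Complex.I) - (n₂ i : ℂ)) =
        ∫ y : ℝ × ℝ, ∑ i, κ i * barnesKernel (p i) (q i) ((-((c₁ : ℝ) : ℂ) + (y.1 : ℂ) * Complex.I) - (n₁ i : ℂ))
          ((-((c₂ : ℝ) : ℂ) + (y.2 : ℂ) * Complex.I) - (n₂ i : ℂ)) := by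
      rw [MeasureTheory.integral_finsetSum _ (fun i _ => (hR i).1.const_mul (κ i))]
      refine Finset.sum_congr rfl fun i _ => ?_
      exact (MeasureTheory.integral_const_mul _ _).symm
    rw [h1]
    simp_rw [hker]
    simp
  -- each summand: κᵢ/Kᵢ · Jᵢ = κᵢ (4π²)⁻¹ ∫Φᵢ
  have hterm : ∀ i, κ i / (barnesPrefactor (p i) (q i) : ℂ) * (Jintegral (p i) (q i) : ℂ) =
      ((4 : ℂ) * (Real.pi : ℂ) ^ 2)⁻¹ * (κ i * ∫ y : ℝ × ℝ, barnesKernel (p i) (q i) ((-((c₁ : ℝ) : ℂ) + (y.1 : ℂ) * Complex.I) - (n₁ i : ℂ))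
          ((-((c₂ : ℝ) : ℂ) + (y.2 : ℂ) * Complex.I) - (n₂ i : ℂ))) := by
    intro i
    rw [(hR i).2]
    set X := ∫ y : ℝ × ℝ, barnesKernel (p i) (q i) ((-((c₁ : ℝ) : ℂ) + (y.1 : ℂ) * Complex.I) - (n₁ i : ℂ))
          ((-((c₂ : ℝ) : ℂ) + (y.2 : ℂ) * Complex.I) - (n₂ i : ℂ)) with hX
    field_simp [hK i]
  simp_rw [hterm]
  rw [← Finset.mul_sum, hlin, mul_zero]

/-! ## 2. The prefactor in Γ-form, chamber bounds, non-negativity of the letters -/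

/-- For an integer `z ≥ 0`, `Γ(z+1) = (z.toNat)!` in `ℂ`. -/
theorem gamma_int_succ {z : ℤ} (hz : 0 ≤ z) : Complex.Gamma ((z : ℂ) + 1) = ((z.toNat.factorial : ℕ) : ℂ) := by
  obtain ⟨n, rfl⟩ := Int.eq_ofNat_of_zero_le hz
  rw [show ((n : ℤ) : ℂ) = (n : ℂ) by norm_cast, Complex.Gamma_nat_eq_factorial]
  simp

/-- **`K(p;q)` in Γ-form**: `K = Γ(q₁+1)Γ(q₂+1)Γ(q₄+1)Γ(q₅+1)/(Γ(p₀+1)Γ(p₆+1)Γ(p₃+q₃−p₀−p₆+1))` for non-negative arguments. -/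
theorem barnesPrefactor_gamma (p : Fin 7 → ℤ) (q : Fin 5 → ℤ) (h0 : 0 ≤ q 0) (h1 : 0 ≤ q 1) (h3 : 0 ≤ q 3) (h4 : 0 ≤ q 4)
    (hp0 : 0 ≤ p 0) (hp6 : 0 ≤ p 6) (hD : 0 ≤ p 3 + q 2 - p 0 - p 6) :
    (barnesPrefactor p q : ℂ) =
      Complex.Gamma ((q 0 : ℂ) + 1) * Complex.Gamma ((q 1 : ℂ) + 1) * Complex.Gamma ((q 3 : ℂ) + 1) * Complex.Gamma ((q 4 : ℂ) + 1) /
        (Complex.Gamma ((p 0 : ℂ) + 1) * Complex.Gamma ((p 6 : ℂ) + 1) * Complex.Gamma (((p 3 + q 2 - p 0 - p 6 : ℤ) : ℂ) + 1)) := by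
  rw [gamma_int_succ h0, gamma_int_succ h1, gamma_int_succ h3, gamma_int_succ h4, gamma_int_succ hp0, gamma_int_succ hp6,
    gamma_int_succ hD]
  unfold barnesPrefactor
  push_cast
  ring

/-- The ten plain inequalities packed in `ChamberQ`. -/
theorem chamberQ_bounds {p : Fin 7 → ℤ} {q : Fin 5 → ℤ} {c₁ c₂ : ℚ} (h : ChamberQ p q c₁ c₂) :
    0 < c₁ ∧ c₁ < 1 + (p 0 : ℚ) ∧ c₁ < 1 + (p 1 : ℚ) ∧ c₁ < 1 + (p 2 : ℚ) ∧ 0 < c₂ ∧ c₂ < 1 + (p 4 : ℚ) ∧ c₂ < 1 + (p 5 : ℚ) ∧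
      c₂ < 1 + (p 6 : ℚ) ∧ (1 : ℚ) + p 0 + p 6 - q 2 < c₁ + c₂ ∧ c₁ + c₂ < (p 3 : ℚ) + 2 := by
  obtain ⟨h1, h2, h3, h4, h5, h6⟩ := h
  have m1 := min_le_left (p 0 : ℚ) (min (p 1 : ℚ) (p 2 : ℚ))
  have m2 := min_le_right (p 0 : ℚ) (min (p 1 : ℚ) (p 2 : ℚ))
  have m3 := min_le_left (p 1 : ℚ) (p 2 : ℚ)
  have m4 := min_le_right (p 1 : ℚ) (p 2 : ℚ)
  have m5 := min_le_left (p 4 : ℚ) (min (p 5 : ℚ) (p 6 : ℚ))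
  have m6 := min_le_right (p 4 : ℚ) (min (p 5 : ℚ) (p 6 : ℚ))
  have m7 := min_le_left (p 5 : ℚ) (p 6 : ℚ)
  have m8 := min_le_right (p 5 : ℚ) (p 6 : ℚ)
  refine ⟨h1, ?_, ?_, ?_, h3, ?_, ?_, ?_, h5, h6⟩ <;> linarith

/-- Ten plain inequalities ⇒ `ChamberQ`. -/
theorem chamberQ_intro {p : Fin 7 → ℤ} {q : Fin 5 → ℤ} {c₁ c₂ : ℚ} (h1 : 0 < c₁) (h2 : c₁ < 1 + (p 0 : ℚ)) (h3 : c₁ < 1 + (p 1 : ℚ))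
    (h4 : c₁ < 1 + (p 2 : ℚ)) (h5 : 0 < c₂) (h6 : c₂ < 1 + (p 4 : ℚ)) (h7 : c₂ < 1 + (p 5 : ℚ)) (h8 : c₂ < 1 + (p 6 : ℚ))
    (h9 : (1 : ℚ) + p 0 + p 6 - q 2 < c₁ + c₂) (h10 : c₁ + c₂ < (p 3 : ℚ) + 2) : ChamberQ p q c₁ c₂ := by
  refine ⟨h1, ?_, h5, ?_, h9, h10⟩
  · rw [← min_add_add_left, ← min_add_add_left]; exact lt_min h2 (lt_min h3 h4)
  · rw [← min_add_add_left, ← min_add_add_left]; exact lt_min h6 (lt_min h7 h8)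

/-- On a family point, convergence and a non-empty rational chamber force all twelve letters to be `≥ 0`
(`q` and `p₁,…,p₅` are convergence forms or sums of them; `p₀, p₆ > c − 1 > −1`). -/
theorem letters_nonneg {a : Fin 8 → ℤ} {c₁ c₂ : ℚ} (hc : Converges a) (hch : ChamberQ (pOf a) (qOf a) c₁ c₂) :
    (∀ j, 0 ≤ pOf a j) ∧ (∀ j, 0 ≤ qOf a j) := by
  have hb := chamberQ_bounds hch
  have f : ∀ x ∈ convergenceForms a, 0 ≤ x := hc
  simp only [convergenceForms, List.mem_cons, List.not_mem_nil, or_false, forall_eq_or_imp, forall_eq] at f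
  obtain ⟨f0, f1, f2, f3, f4, f5, f6, f7, f8, f9, f10, f11, f12, f13, f14, f15, f16⟩ := f
  obtain ⟨b1, b2, _, _, b5, _, _, b8, _, _⟩ := hb
  have hp0 : 0 ≤ pOf a 0 := by
    have : (-1 : ℚ) < (pOf a 0 : ℚ) := by linarith
    have : (-1 : ℤ) < pOf a 0 := by exact_mod_cast this
    omega
  have hp6 : 0 ≤ pOf a 6 := by
    have : (-1 : ℚ) < (pOf a 6 : ℚ) := by linarith
    have : (-1 : ℤ) < pOf a 6 := by exact_mod_cast this
    omega
  refine ⟨?_, ?_⟩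
  · intro j; fin_cases j
    · exact hp0
    · simp [pOf]; omega
    · simp [pOf]; omega
    · simp [pOf]; omega
    · simp [pOf]; omega
    · simp [pOf]; omega
    · exact hp6
  · intro j; fin_cases j <;> simp [qOf] <;> omega

/-- A complex number with non-zero real part is non-zero. -/
theorem ne_zero_of_re_ne {z : ℂ} (hz : z.re ≠ 0) : z ≠ 0 := fun h0 => hz (by rw [h0]; simp)

/-- `barnesPrefactor_gamma` with the seven relevant letters named (so that `rw` produces clean Γ-arguments). -/
theorem barnesPrefactor_gamma' (p : Fin 7 → ℤ) (q : Fin 5 → ℤ) (x0 x1 x3 x4 y0 y6 d : ℤ)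
    (e0 : q 0 = x0) (e1 : q 1 = x1) (e3 : q 3 = x3) (e4 : q 4 = x4) (f0 : p 0 = y0) (f6 : p 6 = y6) (hd : p 3 + q 2 - p 0 - p 6 = d)
    (h0 : 0 ≤ x0) (h1 : 0 ≤ x1) (h3 : 0 ≤ x3) (h4 : 0 ≤ x4) (hp0 : 0 ≤ y0) (hp6 : 0 ≤ y6) (hD : 0 ≤ d) :
    (barnesPrefactor p q : ℂ) =
      Complex.Gamma ((x0 : ℂ) + 1) * Complex.Gamma ((x1 : ℂ) + 1) * Complex.Gamma ((x3 : ℂ) + 1) * Complex.Gamma ((x4 : ℂ) + 1) /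
        (Complex.Gamma ((y0 : ℂ) + 1) * Complex.Gamma ((y6 : ℂ) + 1) * Complex.Gamma ((d : ℂ) + 1)) := by
  rw [barnesPrefactor_gamma p q (by omega) (by omega) (by omega) (by omega) (by omega) (by omega) (by omega), hd, e0, e1, e3, e4, f0, f6]

end Summit.KontsevichZagierPeriods.Zeta5Search.WedgeDictionary.KernelCells
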